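import Summits.QuantumFields.BalabanUV.Beta.GAN24.DepthTowerPrefactors

/-!
# `BalabanUV.Beta.GAN24.FaceReadCrossedValueDeepPin` — binder row G-an2-4 ∕ (CONV-C), W-slot (α-0), typer's PART VI row **T6-VAL**, the (γ) hand's letter **K7-a AT THE PINS** (the
# levels-`≥ 1` twin of `FaceReadCrossedValueZeroPin`): the right-hand side of this hand's `FaceReadCrossedValueDeep.crossed_faceRead_dressedStep_deep` (road-P2's literal crossed `LS`
# face read of the level-`(j+1)` dressed source at coarse period `P`, table at the W-locus pins `cE = Lc^{d+1}`, `cVH = −½·Lc^{2(d+1)}`) — `4·(c·(−K²))·K²·(Val₁ + Val₂)` with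
# `K = sf·sm·(stepScale_{j+1}·Lc^{d+1})⁻¹`, `Val_i = K_E²·(−½)(½)·sf²·(wVH_{j+1}⁻¹·L_i − wVH_{j+1}⁻¹·(Lc^{d+1}·Lc^{d+1})·D_i)`, `K_E = (sf·sm)⁻¹sf⁻²·(Lc^{d+1}·wE_{j+1})`, `L₁ L₂` the two
# crossed-pattern `E2 d Lc (j+1)` cell pairings at the fine period `Lc·P` and `D₁ D₂` the two `E2 d Lc (j+2)` ones at `P` — is, WITH THE LITERAL's UNITS `sf = sfStep Lc (j+1)`,
# `sm = smStep d Lc (j+1)` (road-P2's `unitK ∕ unitS (sfStep Lc i) (smStep 3 Lc i)`), the polynomial `c·(Lc^{d+1})^{2j}·((L₁ + L₂) − (Lc^{d+1})²·(D₁ + D₂))` (every `d`, every `j`,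
# free `c`), and AT THE PINS `d = 3`, `c = cE₂·Lc^{2(3+1)}`, `cE₂ = Lc^{2(3+1)}`:  `Lc^{8+8(j+1)}·(L₁ + L₂) − Lc^{8+8(j+2)}·(D₁ + D₂)` — the right-hand side of road-P2 g51's END PROBE 4b
# binder `hface : X(FFsym_{P m} b̃_{k+1})(a,b) = Lc^{8+8(k+1)}·PAIRSUM_{k+1}(P(m+1))(a,b) − Lc^{8+8(k+2)}·PAIRSUM_{k+2}(P m)(a,b)` (journal [GAN24P2-G51-PROBE4] l.60330) LETTER FOR LETTER,
# with `PAIRSUM_{k+1}(Lc·P m) = L₁ + L₂`, `PAIRSUM_{k+2}(P m) = D₁ + D₂`; equivalently leaf-03 g73's instantiation map `G k n := 4·P(k)·PAIRSUM_k(P n)` (memo `CELL-LAW-CLOSED-g73.md` §2) with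
# `4·P(k) = Lc^{8+8k}` (`DepthTowerPrefactors.eePrefactor_closed` at `cE = Lc⁴`)
# (G-an2-4 CRUX TEAM (2), seat `b2b-balaban-gan24-formalise-leaf-06` = the (γ) hand, gen 58; journal [GAN24LEAF06-G58-INTENT-1]; answers road-P2 g51's question of l.60330 «is (QD)'s
# right side `4·Pref(j+1)·[PAIRSUM_{j+1}(Lc·P) − Lc^{2(d+1)}·PAIRSUM_{j+2}(P)]` with `Pref` in (I)'s literal product form?» — YES after distributing the two pattern blocks (the `wVH⁻¹`
# sits inside each block in (QD)); this file is that `ring` step with the units multiplied out)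

[folklore] arithmetic (`DepthTowerPrefactors.units_eq`, `field_simp`, `ring`); 0 `def`, 0 cited fact, 0 `def … : Prop`, 0 sorry.  HONEST FRAMING (cell contract, verbatim): «discharging
`BetaPertH` makes Bałaban's UV stability UNCONDITIONAL — a real constructive-QFT result; it is NOT the continuum limit and NOT the Clay problem.»  HONEST DEPENDENCY (verbatim): «continuum
YM on T⁴ ⇐ BetaPertH ∧ nine spine estimates (0/9 proved); BetaPertH ⇐ (D1) ∧ (D4) ∧ CAP+tail; G-an2-4 gates asym, D1 and NE2/3/4.»  A statement about real numbers only (the four pairings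
are free letters): it is NOT `hface` for the literal (that is (QD) at road-P2's root tables + `hPs` + this file), NOT `hXu`; asserts nothing about any kernel; discharges NOTHING of `hX` ∕ (C) ∕
`hB0` ∕ `hBF` ∕ (Q-L); NEVER «G-an2-4 closed» as (CONV-C); NOT D1, NOT `BetaPertH`, NOT continuum, NOT Clay.  2026-08-24; no existing file touched.
-/

noncomputable section

open Literature.MathematicalPhysics.QuantumFieldTheory
open Literature.MathematicalPhysics.QuantumFieldTheory.Balaban1983to89
open Literature.MathematicalPhysics.QuantumFieldTheory.Balaban1983to89.Beta
open BalabanStepJetsSucc (wVH wE)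
open Summit.QuantumFields.BalabanUV.Beta.BorderedHessian (stepScale)
open Summit.QuantumFields.BalabanUV.Beta.GAN24.CombesThomas (sfStep smStep)

namespace Summit.QuantumFields.BalabanUV.Beta.GAN24.FaceReadCrossedValueDeepPin

variable {d : ℕ} {Lc : ℕ} [NeZero Lc]

/-- NOT IN PRINT; OUR BOOKKEEPING.  **K7-a's PREFACTOR MULTIPLIED OUT** (every `d`, every `j`, free quartic scalar `c`, free pairings `L₁ L₂ D₁ D₂`): with the level-`(j+1)` units
`sf = sfStep Lc (j+1) = Lc^{j+1}`, `sm = smStep d Lc (j+1)`, `stepScale d Lc (j+1)`, `wVH d Lc (j+1)`, `wE d Lc (j+1)` and the W-locus amplitude `cE = Lc^{d+1}`, the right-hand side of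
`FaceReadCrossedValueDeep.crossed_faceRead_dressedStep_deep` equals `c·(Lc^{d+1})^{2j}·((L₁ + L₂) − (Lc^{d+1})²·(D₁ + D₂))` — i.e. `4·P(j+1)·(PAIRSUM_{j+1} − ρ·PAIRSUM_{j+2})` with
`DepthTowerPrefactors`' `P(j+1) = (c∕4)·Lc^{2j(d+1)}` and K3's `ρ = Lc^{2(d+1)}`. -/
theorem deep_crossed_prefactor (c L₁ L₂ D₁ D₂ : ℝ) (j : ℕ) :
    4 * ((c * -(((sfStep Lc (j + 1) * smStep d Lc (j + 1)) * (stepScale d Lc (j + 1) * (Lc : ℝ) ^ (d + 1))⁻¹) *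
            ((sfStep Lc (j + 1) * smStep d Lc (j + 1)) * (stepScale d Lc (j + 1) * (Lc : ℝ) ^ (d + 1))⁻¹))) *
          (((sfStep Lc (j + 1) * smStep d Lc (j + 1)) * (stepScale d Lc (j + 1) * (Lc : ℝ) ^ (d + 1))⁻¹) *
            ((sfStep Lc (j + 1) * smStep d Lc (j + 1)) * (stepScale d Lc (j + 1) * (Lc : ℝ) ^ (d + 1))⁻¹))) *
        ((((sfStep Lc (j + 1) * smStep d Lc (j + 1))⁻¹ * ((sfStep Lc (j + 1))⁻¹ * (sfStep Lc (j + 1))⁻¹) * ((Lc : ℝ) ^ (d + 1) * wE d Lc (j + 1))) *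
              ((sfStep Lc (j + 1) * smStep d Lc (j + 1))⁻¹ * ((sfStep Lc (j + 1))⁻¹ * (sfStep Lc (j + 1))⁻¹) * ((Lc : ℝ) ^ (d + 1) * wE d Lc (j + 1)))) *
            ((-(1 / 2 : ℝ)) * (1 / 2 : ℝ) * ((sfStep Lc (j + 1) * sfStep Lc (j + 1)) *
              ((wVH d Lc (j + 1))⁻¹ * L₁ - (wVH d Lc (j + 1))⁻¹ * (((Lc : ℝ) ^ (d + 1) * (Lc : ℝ) ^ (d + 1)) * D₁))))
          + (((sfStep Lc (j + 1) * smStep d Lc (j + 1))⁻¹ * ((sfStep Lc (j + 1))⁻¹ * (sfStep Lc (j + 1))⁻¹) * ((Lc : ℝ) ^ (d + 1) * wE d Lc (j + 1))) *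
              ((sfStep Lc (j + 1) * smStep d Lc (j + 1))⁻¹ * ((sfStep Lc (j + 1))⁻¹ * (sfStep Lc (j + 1))⁻¹) * ((Lc : ℝ) ^ (d + 1) * wE d Lc (j + 1)))) *
            ((-(1 / 2 : ℝ)) * (1 / 2 : ℝ) * ((sfStep Lc (j + 1) * sfStep Lc (j + 1)) *
              ((wVH d Lc (j + 1))⁻¹ * L₂ - (wVH d Lc (j + 1))⁻¹ * (((Lc : ℝ) ^ (d + 1) * (Lc : ℝ) ^ (d + 1)) * D₂)))))
      = c * ((Lc : ℝ) ^ (d + 1)) ^ (2 * j) * ((L₁ + L₂) - ((Lc : ℝ) ^ (d + 1)) ^ 2 * (D₁ + D₂)) := by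
  obtain ⟨h1, h2, h3, h4, h5⟩ := DepthTowerPrefactors.units_eq (d := d) (Lc := Lc) (j + 1)
  rw [h1, h2, h3, h4, h5]
  have hL : (Lc : ℝ) ≠ 0 := Nat.cast_ne_zero.mpr (NeZero.ne Lc)
  have ht : ((Lc : ℝ) ^ (j + 1)) ≠ 0 := pow_ne_zero _ hL
  have hu : ((Lc : ℝ) ^ (d + 1)) ≠ 0 := pow_ne_zero _ hL
  field_simp
  ring

/-- NOT IN PRINT; OUR BOOKKEEPING.  **K7-a AT THE PINS** (`d = 3`, forcing scale `c = cE₂·Lc^{2(3+1)}`, `cE₂ = Lc^{2(3+1)}`; every `j`, free pairings): the right-hand side of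
`FaceReadCrossedValueDeep.crossed_faceRead_dressedStep_deep` with the literal's level-`(j+1)` units is `Lc^{8+8(j+1)}·(L₁ + L₂) − Lc^{8+8(j+2)}·(D₁ + D₂)` — road-P2 g51's END PROBE 4b
binder `hface`'s right-hand side with `PAIRSUM_{j+1}(Lc·P) = L₁ + L₂` and `PAIRSUM_{j+2}(P) = D₁ + D₂`. -/
theorem pin_deep_crossed {cE₂ c : ℝ} (hcE₂ : cE₂ = (Lc : ℝ) ^ (2 * (3 + 1))) (hc : c = cE₂ * (Lc : ℝ) ^ (2 * (3 + 1))) (L₁ L₂ D₁ D₂ : ℝ) (j : ℕ) :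
    4 * ((c * -(((sfStep Lc (j + 1) * smStep 3 Lc (j + 1)) * (stepScale 3 Lc (j + 1) * (Lc : ℝ) ^ (3 + 1))⁻¹) *
            ((sfStep Lc (j + 1) * smStep 3 Lc (j + 1)) * (stepScale 3 Lc (j + 1) * (Lc : ℝ) ^ (3 + 1))⁻¹))) *
          (((sfStep Lc (j + 1) * smStep 3 Lc (j + 1)) * (stepScale 3 Lc (j + 1) * (Lc : ℝ) ^ (3 + 1))⁻¹) *
            ((sfStep Lc (j + 1) * smStep 3 Lc (j + 1)) * (stepScale 3 Lc (j + 1) * (Lc : ℝ) ^ (3 + 1))⁻¹))) *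
        ((((sfStep Lc (j + 1) * smStep 3 Lc (j + 1))⁻¹ * ((sfStep Lc (j + 1))⁻¹ * (sfStep Lc (j + 1))⁻¹) * ((Lc : ℝ) ^ (3 + 1) * wE 3 Lc (j + 1))) *
              ((sfStep Lc (j + 1) * smStep 3 Lc (j + 1))⁻¹ * ((sfStep Lc (j + 1))⁻¹ * (sfStep Lc (j + 1))⁻¹) * ((Lc : ℝ) ^ (3 + 1) * wE 3 Lc (j + 1)))) *
            ((-(1 / 2 : ℝ)) * (1 / 2 : ℝ) * ((sfStep Lc (j + 1) * sfStep Lc (j + 1)) *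
              ((wVH 3 Lc (j + 1))⁻¹ * L₁ - (wVH 3 Lc (j + 1))⁻¹ * (((Lc : ℝ) ^ (3 + 1) * (Lc : ℝ) ^ (3 + 1)) * D₁))))
          + (((sfStep Lc (j + 1) * smStep 3 Lc (j + 1))⁻¹ * ((sfStep Lc (j + 1))⁻¹ * (sfStep Lc (j + 1))⁻¹) * ((Lc : ℝ) ^ (3 + 1) * wE 3 Lc (j + 1))) *
              ((sfStep Lc (j + 1) * smStep 3 Lc (j + 1))⁻¹ * ((sfStep Lc (j + 1))⁻¹ * (sfStep Lc (j + 1))⁻¹) * ((Lc : ℝ) ^ (3 + 1) * wE 3 Lc (j + 1)))) *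
            ((-(1 / 2 : ℝ)) * (1 / 2 : ℝ) * ((sfStep Lc (j + 1) * sfStep Lc (j + 1)) *
              ((wVH 3 Lc (j + 1))⁻¹ * L₂ - (wVH 3 Lc (j + 1))⁻¹ * (((Lc : ℝ) ^ (3 + 1) * (Lc : ℝ) ^ (3 + 1)) * D₂)))))
      = (Lc : ℝ) ^ (8 + 8 * (j + 1)) * (L₁ + L₂) - (Lc : ℝ) ^ (8 + 8 * (j + 2)) * (D₁ + D₂) := by
  rw [deep_crossed_prefactor (d := 3) (Lc := Lc) c L₁ L₂ D₁ D₂ j]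
  subst hcE₂ hc
  ring

/-- NOT IN PRINT; OUR BOOKKEEPING.  **THE SAME IN leaf-03 g73's `G`-LETTERS** (`CELL-LAW-CLOSED-g73.md` §2: `G k n a b := 4·P(k)·PAIRSUM_k(P n)(a,b)` with `4·P(k) = Lc^{8+8k}` at the pins):
the pinned right-hand side is `G (j+1) (m+1) − G (j+2) m` with `G (j+1) (m+1) = Lc^{8+8(j+1)}·(L₁ + L₂)` (fine period `Lc·P m = P (m+1)`) and `G (j+2) m = Lc^{8+8(j+2)}·(D₁ + D₂)` (period `P m`) —
the POTENTIAL FORM `hface` of `CrossedLedgerClosure` ∕ `CrossedLedgerForcingCell` for free pattern-dependent `G`, stated here for any `G : ℕ → ℕ → ℝ` agreeing with those two products. -/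
theorem pin_deep_crossed_potential {cE₂ c : ℝ} (hcE₂ : cE₂ = (Lc : ℝ) ^ (2 * (3 + 1))) (hc : c = cE₂ * (Lc : ℝ) ^ (2 * (3 + 1))) (L₁ L₂ D₁ D₂ : ℝ) (j m : ℕ)
    {G : ℕ → ℕ → ℝ} (hG₁ : G (j + 1) (m + 1) = (Lc : ℝ) ^ (8 + 8 * (j + 1)) * (L₁ + L₂)) (hG₂ : G (j + 2) m = (Lc : ℝ) ^ (8 + 8 * (j + 2)) * (D₁ + D₂)) :
    4 * ((c * -(((sfStep Lc (j + 1) * smStep 3 Lc (j + 1)) * (stepScale 3 Lc (j + 1) * (Lc : ℝ) ^ (3 + 1))⁻¹) *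
            ((sfStep Lc (j + 1) * smStep 3 Lc (j + 1)) * (stepScale 3 Lc (j + 1) * (Lc : ℝ) ^ (3 + 1))⁻¹))) *
          (((sfStep Lc (j + 1) * smStep 3 Lc (j + 1)) * (stepScale 3 Lc (j + 1) * (Lc : ℝ) ^ (3 + 1))⁻¹) *
            ((sfStep Lc (j + 1) * smStep 3 Lc (j + 1)) * (stepScale 3 Lc (j + 1) * (Lc : ℝ) ^ (3 + 1))⁻¹))) *
        ((((sfStep Lc (j + 1) * smStep 3 Lc (j + 1))⁻¹ * ((sfStep Lc (j + 1))⁻¹ * (sfStep Lc (j + 1))⁻¹) * ((Lc : ℝ) ^ (3 + 1) * wE 3 Lc (j + 1))) *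
              ((sfStep Lc (j + 1) * smStep 3 Lc (j + 1))⁻¹ * ((sfStep Lc (j + 1))⁻¹ * (sfStep Lc (j + 1))⁻¹) * ((Lc : ℝ) ^ (3 + 1) * wE 3 Lc (j + 1)))) *
            ((-(1 / 2 : ℝ)) * (1 / 2 : ℝ) * ((sfStep Lc (j + 1) * sfStep Lc (j + 1)) *
              ((wVH 3 Lc (j + 1))⁻¹ * L₁ - (wVH 3 Lc (j + 1))⁻¹ * (((Lc : ℝ) ^ (3 + 1) * (Lc : ℝ) ^ (3 + 1)) * D₁))))
          + (((sfStep Lc (j + 1) * smStep 3 Lc (j + 1))⁻¹ * ((sfStep Lc (j + 1))⁻¹ * (sfStep Lc (j + 1))⁻¹) * ((Lc : ℝ) ^ (3 + 1) * wE 3 Lc (j + 1))) *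
              ((sfStep Lc (j + 1) * smStep 3 Lc (j + 1))⁻¹ * ((sfStep Lc (j + 1))⁻¹ * (sfStep Lc (j + 1))⁻¹) * ((Lc : ℝ) ^ (3 + 1) * wE 3 Lc (j + 1)))) *
            ((-(1 / 2 : ℝ)) * (1 / 2 : ℝ) * ((sfStep Lc (j + 1) * sfStep Lc (j + 1)) *
              ((wVH 3 Lc (j + 1))⁻¹ * L₂ - (wVH 3 Lc (j + 1))⁻¹ * (((Lc : ℝ) ^ (3 + 1) * (Lc : ℝ) ^ (3 + 1)) * D₂)))))
      = G (j + 1) (m + 1) - G (j + 2) m := by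
  rw [pin_deep_crossed (Lc := Lc) hcE₂ hc L₁ L₂ D₁ D₂ j, hG₁, hG₂]

end Summit.QuantumFields.BalabanUV.Beta.GAN24.FaceReadCrossedValueDeepPin

end
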